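import Summits.PneNP.PneNP.Theorems.NegLimitedAmplifiedWindowAmpDefs
import Mathlib
import HarnessLib

/-!
# Amplified critical window — stub A, parts A3 / A3' / A5 / A6 (generic finite sums)
(cell pnp-ideate, rung F-N1/p3, ROUND-12; line `amplified-window` on item stmt-PneNP-19860, stub A
`MonotoneAmplification`; typed parts `Amp.*` of `NegLimitedAmplifiedWindowAmpDefs.lean`, blueprint
HOME/pnp-ideate-p3/r12/BLUEPRINT-A.md §5, §7)

The four hypothesis-free finite-sum parts of p3's decomposition of stub A, BY NAME:
* `mixtureExpansion_holds : MixtureExpansion` — `∏_w (μ₁+μ₂)(X_w) = Σ_S ∏_{w∈S} μ₁ ∏_{w∉S} μ₂`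
  (`Finset.prod_add`) and linearity of `agreeAt` in the weight;
* `curryBridge_holds : CurryBridge` — `Equiv.curry`;
* `finalHybridBound_holds : FinalHybridBound` — against independent fair coins any test agrees with the
  combiner with probability `½ + sgn(test)·cbias/2 ≤ (1 + |cbias|)/2`;
* `pushforward_holds : Pushforward` — from the generic pushforward identity `sum_bw_mul_comp`
  (`Σ_X (∏_w μ_w(X_w))·h(π ∘ X) = Σ_v (∏_w μ_w(π⁻¹(v_w)))·h(v)`, `Finset.prod_univ_sum`), which the bias-decay
  part (A7) reuses for the `(S, v) ↦ ρ` re-indexing of restrictions.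

References: R. O'Donnell, *Hardness amplification within NP*, JCSS 69 (2004), §3; A. Healy, S. Vadhan, E. Viola,
*Using nondeterminism to amplify hardness*, SICOMP 35 (2006), §3 [HealyVadhanViola2006].

HONEST FRAMING: elementary finite-sum identities for the OPEN stub A; nothing here bears on P vs NP.
-/

set_option linter.dupNamespace false -- `Summit.PneNP.PneNP.…`: summit = sub-problem name (D-0017 single-conjunct layout)

namespace Summit.PneNP.PneNP.Theorems.NegLimitedAmplifiedWindow.Amp

open Finset
open Literature.Computability.Complexity
open Summit.PneNP.PneNP.Theorems.NegLimitedDoor (massAt agreeAt)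

section Generic

variable {W 𝒳 : Type} [Fintype W] [DecidableEq W] [Fintype 𝒳]

/-- Total block-product weight: `Σ_X ∏_w μ_w(X_w) = ∏_w Σ_a μ_w(a)`. -/
theorem sum_bw_eq_prod (μ : W → 𝒳 → ℝ) : ∑ X : W → 𝒳, bw μ X = ∏ w, ∑ a, μ w a := by
  classical
  unfold bw
  rw [Finset.prod_univ_sum, Fintype.piFinset_univ]

omit [DecidableEq W] [Fintype 𝒳] in
/-- The block-product weight is nonnegative for nonnegative block weights. -/
theorem bw_nonneg {μ : W → 𝒳 → ℝ} (hμ : ∀ w a, 0 ≤ μ w a) (X : W → 𝒳) : 0 ≤ bw μ X :=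
  prod_nonneg fun w _ => hμ w (X w)

/-- **Generic pushforward**: a block-product sum of a function of the block IMAGES `π (X_w)` is the
product-of-fibre-masses sum over image vectors. -/
theorem sum_bw_mul_comp {𝒴 : Type} [Fintype 𝒴] [DecidableEq 𝒴] (μ : W → 𝒳 → ℝ) (π : 𝒳 → 𝒴)
    (h : (W → 𝒴) → ℝ) :
    ∑ X : W → 𝒳, bw μ X * h (fun w => π (X w)) =
      ∑ v : W → 𝒴, (∏ w, ∑ a ∈ univ.filter (fun a => π a = v w), μ w a) * h v := by
  classical
  -- fibre decomposition along `v = π ∘ X`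
  have hfib : ∀ X : W → 𝒳, bw μ X * h (fun w => π (X w)) =
      ∑ v : W → 𝒴, if (fun w => π (X w)) = v then bw μ X * h v else 0 := fun X => by
    rw [Finset.sum_ite_eq]; simp
  rw [Finset.sum_congr rfl fun X _ => hfib X, Finset.sum_comm]
  refine Finset.sum_congr rfl fun v _ => ?_
  -- the fibre of `v` is the box `piFinset (π⁻¹ (v w))_w`
  have hbox : ∀ X : W → 𝒳, ((fun w => π (X w)) = v) ↔
      X ∈ Fintype.piFinset fun w => univ.filter fun a => π a = v w := fun X => by
    rw [Fintype.mem_piFinset]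
    simp only [mem_filter, mem_univ, true_and]
    exact ⟨fun h w => by rw [← h], fun h => funext h⟩
  rw [Finset.prod_univ_sum, Finset.sum_mul]
  rw [← Finset.sum_filter]
  refine Finset.sum_congr ?_ fun X _ => rfl
  ext X
  simp only [mem_filter, mem_univ, true_and, hbox X]

end Generic

/-- **A6 `Pushforward`**, BY NAME. -/
theorem pushforward_holds : Pushforward := by
  intro W 𝒳 _ _ _ μ f h
  classical
  rw [sum_bw_mul_comp μ f h]
  refine Finset.sum_congr rfl fun v _ => ?_
  congr 1
  refine Finset.prod_congr rfl fun w _ => ?_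
  rw [Summit.PneNP.PneNP.Theorems.NegLimitedDoor.massAt_eq_sum_filter]

/-- **A3 `MixtureExpansion`**, BY NAME. -/
theorem mixtureExpansion_holds : MixtureExpansion := by
  intro W 𝒳 _ _ _ μ₁ μ₂ F g
  classical
  -- `agreeAt μ F g = Σ_X [g X = F X]·μ X`
  have hagree : ∀ μ : (W → 𝒳) → ℝ, agreeAt μ F g = ∑ X, (if g X = F X then (1 : ℝ) else 0) * μ X := fun μ => by
    unfold agreeAt
    exact Finset.sum_congr rfl fun X _ => by split_ifs <;> simp
  simp_rw [hagree]
  -- expand the product weight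
  have hbw : ∀ X : W → 𝒳, bw (fun _ : W => μ₁ + μ₂) X =
      ∑ S : Finset W, bw (fun w => if w ∈ S then μ₁ else μ₂) X := fun X => by
    unfold bw
    simp only [Pi.add_apply]
    rw [Finset.prod_add, Finset.powerset_univ]
    refine Finset.sum_congr rfl fun S _ => ?_
    have hpt : ∀ x, (if x ∈ S then μ₁ else μ₂) (X x) = if x ∈ S then μ₁ (X x) else μ₂ (X x) :=
      fun x => by split_ifs <;> rfl
    simp only [hpt]
    rw [Finset.prod_ite, Finset.filter_univ_mem]
    congr 1
    refine Finset.prod_congr ?_ fun w _ => rfl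
    ext w; simp [Finset.mem_sdiff]
  simp_rw [hbw, Finset.mul_sum]
  rw [Finset.sum_comm]

/-- **A3' `CurryBridge`**, BY NAME. -/
theorem curryBridge_holds : CurryBridge := by
  intro ι _ _ d D f g
  unfold agreeAt
  exact Fintype.sum_equiv (Equiv.curry (Fin d → Fin 3) ι Bool) _ _ fun x => rfl

/-- Agreement indicator through signs: `[b = c] = (1 + sgn b · sgn c)/2`. -/
theorem ite_eq_eq_sgn (b c : Bool) : (if b = c then (1 : ℝ) else 0) = (1 + sgn b * sgn c) / 2 := by
  cases b <;> cases c <;> simp [sgn]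

/-- **A5 `FinalHybridBound`**, BY NAME: against fair coins on the hard blocks any test agrees with the
combiner with probability `≤ (1 + |cbias|)/2`. -/
theorem finalHybridBound_holds : FinalHybridBound := by
  intro W 𝒳 _ _ _ μ f Φ g S hμ
  classical
  unfold hybAgree
  rw [← sum_bw_eq_prod, Finset.mul_sum, Finset.mul_sum, ← Finset.sum_add_distrib]
  refine Finset.sum_le_sum fun X _ => ?_
  -- pointwise in `X`
  set N := Fintype.card W
  set c := cbias Φ S (fun w => f (X w)) with hc
  have hinner : ((2 : ℝ) ^ N)⁻¹ * ∑ z : W → Bool,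
      (if g X = Φ (fun w => if w ∈ S then z w else f (X w)) then (1 : ℝ) else 0) =
        1 / 2 + sgn (g X) * c / 2 := by
    have h1 : ∑ z : W → Bool, (if g X = Φ (fun w => if w ∈ S then z w else f (X w)) then (1 : ℝ) else 0) =
        ∑ z : W → Bool, (1 + sgn (g X) * sgn (Φ (fun w => if w ∈ S then z w else f (X w)))) / 2 :=
      Finset.sum_congr rfl fun z _ => ite_eq_eq_sgn _ _
    have h2 : ∑ z : W → Bool, (1 + sgn (g X) * sgn (Φ (fun w => if w ∈ S then z w else f (X w)))) / 2 =
        ((2 : ℝ) ^ N + sgn (g X) * ∑ z : W → Bool, sgn (Φ (fun w => if w ∈ S then z w else f (X w)))) / 2 := by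
      rw [← Finset.sum_div, Finset.sum_add_distrib, ← Finset.mul_sum]
      simp only [Finset.sum_const, Finset.card_univ, Fintype.card_fun, Fintype.card_bool, nsmul_eq_mul,
        mul_one, Nat.cast_pow, Nat.cast_ofNat, N]
    have hcd : c = ((2 : ℝ) ^ N)⁻¹ * ∑ z : W → Bool, sgn (Φ (fun w => if w ∈ S then z w else f (X w))) := by
      rw [hc, cbias]
    rw [h1, h2, hcd]
    have h2N : (2 : ℝ) ^ N ≠ 0 := by positivity
    field_simp
  rw [hinner]
  have hbw := bw_nonneg hμ X
  have hle : sgn (g X) * c ≤ |c| := by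
    calc sgn (g X) * c ≤ |sgn (g X) * c| := le_abs_self _
      _ = |c| := by
          have habs : |sgn (g X)| = 1 := by cases g X <;> simp [sgn]
          rw [abs_mul, habs, one_mul]
  nlinarith

end Summit.PneNP.PneNP.Theorems.NegLimitedAmplifiedWindow.Amp
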